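import Summits.Ventures.GridStability.Models.StructurePreservingDAEHessian
import Literature.Computation.Certificates.PosSemidefDecide
import HarnessLib

/-!
# GridStability/Models/StructurePreservingDAEHessianMatrix — the second variation of the structure-
# preserving energy as an explicit MATRIX over any field (exact-rational on half-angle data), and the
# bridge from an in-kernel `LDLᵀ` positive-definiteness certificate of the PINNED matrix to positivity
# of `hessianQuad` on the pinned directions

LADDER-GRIDFUSION G3 (model register), seat gridfusion-model-2 (g9); `plan/MODEL-VALIDITY.md` row
**MV-4** (c)(i): «index-1: ∂g/∂(V, φ) nonsingular on D — itself certifiable». At an operating point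
whose angles are half-angle rationals (`θ = 2·arctan t`, so `cos`, `sin` are rational) and whose
data are rational, the second variation `hessianQuad` of [cite: Padiyar2013, §3.4.4 eq (3.32)] is a
quadratic form with RATIONAL Gram matrix; this file names that matrix and proves the identity, so that
an instance file can certify positive definiteness of the pinned matrix by ONE `decide +kernel`
(`Literature.Computation.Certificates.PSD.LDLCertPD`, exact `LDLᵀ` in the kernel
[cite: BlekhermanParriloThomas2012, App. A.1.2]) and conclude, via
`StructurePreservingDAEStability.forall_dist_pinnedState_lt_of_hessianQuad_pos`, Liapunov stability of
the operating point modulo rotation. (The `(θ, V)`-block of this matrix is the Jacobian of the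
power-flow equations (7.195)–(7.196) w.r.t. the algebraic variables, scaled by `1/V` on the reactive
rows — its nonsingularity is the index-1 condition AT THE POINT; positive definiteness of the whole
pinned matrix is the «high-voltage solution = energy minimum» reading of [cite: SauerPai1998, §9.8].)

## Contents (all PROVED; generic in the field `K`; MODELLED column)
* `HessianTables K m n` — the data the second variation depends on: `E, X′_d, bus, B, V`, the
  cos/sin TABLES of machine and bus angles, and the reactive-load coefficients
  `q_k = (Q′_Lk(V_k)V_k − Q_Lk(V_k))/V_k²`; `map` along a ring hom (ℚ → ℝ);
* `quad` — `hessianQuad` written in the tables (`cos(δᵢ−θ_b) = cδᵢcθ_b + sδᵢsθ_b`, …);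
  `Matches` + `hessianQuad_eq_quad` — over `ℝ`, with the true cos/sin values, `quad = hessianQuad`;
* `matrix : Matrix (Fin m ⊕ (Fin n ⊕ Fin n)) _ K` — the Gram matrix, assembled as a sum of elementary
  symmetric pieces (machine reactance / network pair / load), `qf` the quadratic form
  `Σ_I Σ_J d_I M_IJ d_J`, and **`quad_eq_qf`**: `quad a u φ = qf matrix (Sum.elim a (Sum.elim φ u))`;
  `matrix_map` (casting commutes);
* `qf_pos_of_ldlCertPD` — if the submatrix on an injective index map `f : Fin N → _` (the pinning:
  `f` misses the pinned bus angle) carries `PSD.LDLCertPD`, then `qf` of the real-cast matrix is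
  positive on every nonzero real direction supported on `range f`.
No instance here (instances: `WSCC9DAELocalMin.lean`). [cite: Padiyar2013, §3.4.4 eqs (3.32)–(3.37)]
-/

noncomputable section

open Finset Matrix

namespace Summit.Ventures.GridStability.Models.StructurePreservingDAE

/-- The data of the second variation at a state: machine EMFs `E`, transient reactances `X′_d`,
terminal buses, susceptances `B`, bus voltages `V`, the cosine/sine TABLES of the machine angles
(`cδ, sδ`) and bus angles (`cθ, sθ`), and the reactive-load coefficients
`q_k = (Q′_Lk(V_k)V_k − Q_Lk(V_k))/V_k²`. Over `ℚ` for half-angle operating points; over `ℝ` for the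
true values. [cite: Padiyar2013, §3.4.4 eq (3.32)] -/
structure HessianTables (K : Type*) (m n : ℕ) where
  /-- internal EMF magnitudes `Eᵢ` -/
  E : Fin m → K
  /-- transient reactances `X′_dᵢ` -/
  X : Fin m → K
  /-- terminal bus of machine `i` -/
  bus : Fin m → Fin n
  /-- susceptance matrix `B_kl` -/
  B : Fin n → Fin n → K
  /-- bus voltage magnitudes `V_k` -/
  V : Fin n → K
  /-- `cos δᵢ` -/
  cδ : Fin m → K
  /-- `sin δᵢ` -/
  sδ : Fin m → K
  /-- `cos θ_k` -/
  cθ : Fin n → K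
  /-- `sin θ_k` -/
  sθ : Fin n → K
  /-- reactive-load coefficient `(Q′_Lk(V_k)V_k − Q_Lk(V_k))/V_k²` -/
  q : Fin n → K

namespace HessianTables

variable {K : Type*} [Field K] {L : Type*} [Field L] {m n : ℕ}

/-- Transport the tables along a ring homomorphism (used with `Rat.castHom ℝ`). -/
def map (f : K →+* L) (T : HessianTables K m n) : HessianTables L m n where
  E := fun i => f (T.E i)
  X := fun i => f (T.X i)
  bus := T.bus
  B := fun k l => f (T.B k l)
  V := fun k => f (T.V k)
  cδ := fun i => f (T.cδ i)
  sδ := fun i => f (T.sδ i)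
  cθ := fun k => f (T.cθ k)
  sθ := fun k => f (T.sθ k)
  q := fun k => f (T.q k)

/-- `cos(δᵢ − θ_b)` from the tables (`b` the terminal bus of machine `i`). -/
def Cm (T : HessianTables K m n) (i : Fin m) : K :=
  T.cδ i * T.cθ (T.bus i) + T.sδ i * T.sθ (T.bus i)

/-- `sin(δᵢ − θ_b)` from the tables. -/
def Sm (T : HessianTables K m n) (i : Fin m) : K :=
  T.sδ i * T.cθ (T.bus i) - T.cδ i * T.sθ (T.bus i)

/-- `cos(θ_k − θ_l)` from the tables. -/
def Cb (T : HessianTables K m n) (k l : Fin n) : K := T.cθ k * T.cθ l + T.sθ k * T.sθ l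

/-- `sin(θ_k − θ_l)` from the tables. -/
def Sb (T : HessianTables K m n) (k l : Fin n) : K := T.sθ k * T.cθ l - T.cθ k * T.sθ l

/-- The second variation WRITTEN IN THE TABLES: the formula of `Params.hessianQuad` with every
`cos`/`sin` of an angle difference expanded by the addition theorems. [cite: Padiyar2013, §3.4.4 eqs (3.33)–(3.37)] -/
def quad (T : HessianTables K m n) (a : Fin m → K) (u φ : Fin n → K) : K :=
  ∑ i, (2 * u (T.bus i) ^ 2
      + 2 * T.E i * (2 * u (T.bus i) * (a i - φ (T.bus i)) * T.Sm i
        + T.V (T.bus i) * (a i - φ (T.bus i)) ^ 2 * T.Cm i)) / (2 * T.X i)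
  + -(1 / 2) * ∑ k, ∑ l, T.B k l * (2 * u k * u l * T.Cb k l
      - 2 * (u k * T.V l + T.V k * u l) * (φ k - φ l) * T.Sb k l
      - T.V k * T.V l * (φ k - φ l) ^ 2 * T.Cb k l)
  - ∑ k, T.q k * u k ^ 2

/-- The real tables MATCH a parameter record, a reactive derivative field and a state: same data,
`cδᵢ = cos δᵢ`, …, `q_k = (Q′_Lk(V_k)V_k − Q_Lk(V_k))/V_k²`. -/
structure Matches (T : HessianTables ℝ m n) (p : Params m n) (QL' : Fin n → ℝ → ℝ) (δ : Fin m → ℝ)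
    (V θ : Fin n → ℝ) : Prop where
  E_eq : ∀ i, T.E i = p.E i
  X_eq : ∀ i, T.X i = p.Xd' i
  bus_eq : ∀ i, T.bus i = p.bus i
  B_eq : ∀ k l, T.B k l = p.B k l
  V_eq : ∀ k, T.V k = V k
  cδ_eq : ∀ i, T.cδ i = Real.cos (δ i)
  sδ_eq : ∀ i, T.sδ i = Real.sin (δ i)
  cθ_eq : ∀ k, T.cθ k = Real.cos (θ k)
  sθ_eq : ∀ k, T.sθ k = Real.sin (θ k)
  q_eq : ∀ k, T.q k = (QL' k (V k) * V k - p.QL k (V k)) / V k ^ 2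

/-- **Matching real tables reproduce the second variation**: `hessianQuad = quad`.
[cite: Padiyar2013, §3.4.4 eqs (3.33)–(3.37)] -/
theorem hessianQuad_eq_quad {T : HessianTables ℝ m n} {p : Params m n} {QL' : Fin n → ℝ → ℝ}
    {δ : Fin m → ℝ} {V θ : Fin n → ℝ} (h : T.Matches p QL' δ V θ) (a : Fin m → ℝ)
    (u φ : Fin n → ℝ) : p.hessianQuad QL' δ a V θ u φ = T.quad a u φ := by
  simp only [Params.hessianQuad, quad, Cm, Sm, Cb, Sb, Real.cos_sub, Real.sin_sub, h.E_eq, h.X_eq,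
    h.bus_eq, h.B_eq, h.V_eq, h.cδ_eq, h.sδ_eq, h.cθ_eq, h.sθ_eq, h.q_eq]

/-! ### The Gram matrix -/

/-- Index of the direction coordinates: machine angles `δᵢ`, then bus angles `θ_k`, then bus
voltages `V_k`. -/
abbrev Idx (m n : ℕ) : Type := Fin m ⊕ (Fin n ⊕ Fin n)

/-- The direction `(a, u, φ)` as a vector on `Idx`: `inl i ↦ aᵢ`, `inr (inl k) ↦ φ_k`, `inr (inr k) ↦ u_k`. -/
def dir {R : Type*} (a : Fin m → R) (u φ : Fin n → R) : Idx m n → R := Sum.elim a (Sum.elim φ u)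

/-- The quadratic form `Σ_I Σ_J d_I M_IJ d_J` of a square matrix (the shape of
`PSD.LDLCertPD.quadForm_pos`). [folklore] -/
def qf {ι : Type*} [Fintype ι] {R : Type*} [CommRing R] (M : Matrix ι ι R) (d : ι → R) : R :=
  ∑ I, ∑ J, d I * M I J * d J

/-- Symmetric elementary piece: `c/2` at `(I, J)` and at `(J, I)` — quadratic form `c·d_I·d_J`. -/
def cross {ι : Type*} [DecidableEq ι] (I J : ι) (c : K) : Matrix ι ι K :=
  Matrix.single I J (c / 2) + Matrix.single J I (c / 2)

/-- Machine-reactance piece of the Gram matrix (machine `i`, terminal bus `b`, `g = E/X′_d`):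
`u_b²/X + 2gS u_b(aᵢ − φ_b) + gV_bC(aᵢ − φ_b)²` expanded. [cite: Padiyar2013, §3.4.4 eq (3.32)] -/
def machinePiece (T : HessianTables K m n) (i : Fin m) : Matrix (Idx m n) (Idx m n) K :=
  let b := T.bus i
  let g := T.E i / T.X i
  cross (Sum.inr (Sum.inr b)) (Sum.inr (Sum.inr b)) (1 / T.X i)
  + cross (Sum.inl i) (Sum.inr (Sum.inr b)) (2 * g * T.Sm i)
  + cross (Sum.inr (Sum.inl b)) (Sum.inr (Sum.inr b)) (-(2 * g * T.Sm i))
  + cross (Sum.inl i) (Sum.inl i) (g * T.V b * T.Cm i)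
  + cross (Sum.inl i) (Sum.inr (Sum.inl b)) (-(2 * (g * T.V b * T.Cm i)))
  + cross (Sum.inr (Sum.inl b)) (Sum.inr (Sum.inl b)) (g * T.V b * T.Cm i)

/-- Network piece of the Gram matrix for the ordered bus pair `(k, l)`:
`−B C u_k u_l + B S (u_kV_l + V_ku_l)(φ_k − φ_l) + ½ B V_kV_l C (φ_k − φ_l)²` expanded.
[cite: Padiyar2013, §3.4.4 eq (3.32)] -/
def networkPiece (T : HessianTables K m n) (k l : Fin n) : Matrix (Idx m n) (Idx m n) K :=
  let w := T.B k l
  cross (Sum.inr (Sum.inr k)) (Sum.inr (Sum.inr l)) (-(w * T.Cb k l))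
  + cross (Sum.inr (Sum.inr k)) (Sum.inr (Sum.inl k)) (w * T.Sb k l * T.V l)
  + cross (Sum.inr (Sum.inr k)) (Sum.inr (Sum.inl l)) (-(w * T.Sb k l * T.V l))
  + cross (Sum.inr (Sum.inr l)) (Sum.inr (Sum.inl k)) (w * T.Sb k l * T.V k)
  + cross (Sum.inr (Sum.inr l)) (Sum.inr (Sum.inl l)) (-(w * T.Sb k l * T.V k))
  + cross (Sum.inr (Sum.inl k)) (Sum.inr (Sum.inl k)) (w * T.V k * T.V l * T.Cb k l / 2)
  + cross (Sum.inr (Sum.inl k)) (Sum.inr (Sum.inl l)) (-(w * T.V k * T.V l * T.Cb k l))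
  + cross (Sum.inr (Sum.inl l)) (Sum.inr (Sum.inl l)) (w * T.V k * T.V l * T.Cb k l / 2)

/-- Reactive-load piece: `−q_k u_k²`. [cite: Padiyar2013, §3.4.4 eq (3.32)] -/
def loadPiece (T : HessianTables K m n) (k : Fin n) : Matrix (Idx m n) (Idx m n) K :=
  cross (Sum.inr (Sum.inr k)) (Sum.inr (Sum.inr k)) (-T.q k)

/-- **The Gram matrix of the second variation** (symmetric by construction):
`Σᵢ machinePiece + Σ_k Σ_l networkPiece + Σ_k loadPiece`. [cite: Padiyar2013, §3.4.4 eq (3.32)] -/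
def matrix (T : HessianTables K m n) : Matrix (Idx m n) (Idx m n) K :=
  ∑ i, T.machinePiece i + ∑ k, ∑ l, T.networkPiece k l + ∑ k, T.loadPiece k

/-! ### The quadratic-form identity -/

section qf

variable {ι : Type*} [Fintype ι]

/-- `qf` is additive in the matrix. [folklore] -/
theorem qf_add {R : Type*} [CommRing R] (M N : Matrix ι ι R) (d : ι → R) :
    qf (M + N) d = qf M d + qf N d := by
  simp only [qf, Matrix.add_apply, mul_add, add_mul, Finset.sum_add_distrib]

/-- `qf` of a finite sum of matrices. [folklore] -/
theorem qf_sum {R : Type*} [CommRing R] {β : Type*} (s : Finset β) (M : β → Matrix ι ι R)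
    (d : ι → R) : qf (∑ t ∈ s, M t) d = ∑ t ∈ s, qf (M t) d := by
  classical
  refine Finset.induction_on s (by simp [qf]) fun t s ht ih => ?_
  rw [Finset.sum_insert ht, Finset.sum_insert ht, qf_add, ih]

/-- `qf` of an elementary matrix. [folklore] -/
theorem qf_single [DecidableEq ι] {R : Type*} [CommRing R] (I J : ι) (c : R) (d : ι → R) :
    qf (Matrix.single I J c) d = c * d I * d J := by
  unfold qf
  rw [Finset.sum_eq_single_of_mem I (Finset.mem_univ _) fun I' _ hI' =>
      Finset.sum_eq_zero fun J' _ => by rw [Matrix.single_apply_of_row_ne hI'.symm]; ring,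
    Finset.sum_eq_single_of_mem J (Finset.mem_univ _) fun J' _ hJ' => by
      rw [Matrix.single_apply_of_col_ne _ _ hJ'.symm]; ring]
  rw [Matrix.single_apply_same]
  ring

/-- `qf` of the symmetric elementary piece: `c·d_I·d_J`. [folklore] -/
theorem qf_cross [DecidableEq ι] [CharZero K] (I J : ι) (c : K) (d : ι → K) :
    qf (cross I J c) d = c * d I * d J := by
  rw [cross, qf_add, qf_single, qf_single]
  ring

end qf

/-- Casting the tables casts the Gram matrix entrywise. [folklore] -/
theorem matrix_map (f : K →+* L) (T : HessianTables K m n) :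
    (T.map f).matrix = T.matrix.map f := by
  ext I J
  simp only [matrix, machinePiece, networkPiece, loadPiece, cross, map, Cm, Sm, Cb, Sb,
    Matrix.map_apply, Matrix.add_apply, Matrix.sum_apply, Matrix.single, Matrix.of_apply,
    map_add, map_sum, apply_ite f, map_zero, map_div₀, map_mul, map_sub, map_neg, map_one,
    map_ofNat]

/-- Casting commutes with `quad` (for directions in the image). [folklore] -/
theorem quad_map (f : K →+* L) (T : HessianTables K m n) (a : Fin m → K) (u φ : Fin n → K) :
    (T.map f).quad (fun i => f (a i)) (fun k => f (u k)) (fun k => f (φ k)) = f (T.quad a u φ) := by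
  simp only [quad, map, Cm, Sm, Cb, Sb, map_add, map_sub, map_neg, map_mul, map_sum, map_div₀,
    map_pow, map_ofNat, map_one]

variable [CharZero K]

/-- Quadratic form of the machine piece. [cite: Padiyar2013, §3.4.4 eq (3.32)] -/
theorem qf_machinePiece (T : HessianTables K m n) (i : Fin m) (a : Fin m → K) (u φ : Fin n → K)
    (hX : T.X i ≠ 0) :
    qf (T.machinePiece i) (dir a u φ)
      = (2 * u (T.bus i) ^ 2 + 2 * T.E i * (2 * u (T.bus i) * (a i - φ (T.bus i)) * T.Sm i
          + T.V (T.bus i) * (a i - φ (T.bus i)) ^ 2 * T.Cm i)) / (2 * T.X i) := by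
  simp only [machinePiece, qf_add, qf_cross, dir, Sum.elim_inl, Sum.elim_inr]
  field_simp
  ring

/-- Quadratic form of the network piece. [cite: Padiyar2013, §3.4.4 eq (3.32)] -/
theorem qf_networkPiece (T : HessianTables K m n) (k l : Fin n) (a : Fin m → K) (u φ : Fin n → K) :
    qf (T.networkPiece k l) (dir a u φ)
      = -(1 / 2) * (T.B k l * (2 * u k * u l * T.Cb k l
          - 2 * (u k * T.V l + T.V k * u l) * (φ k - φ l) * T.Sb k l
          - T.V k * T.V l * (φ k - φ l) ^ 2 * T.Cb k l)) := by
  simp only [networkPiece, qf_add, qf_cross, dir, Sum.elim_inl, Sum.elim_inr]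
  ring

/-- Quadratic form of the load piece. [cite: Padiyar2013, §3.4.4 eq (3.32)] -/
theorem qf_loadPiece (T : HessianTables K m n) (k : Fin n) (a : Fin m → K) (u φ : Fin n → K) :
    qf (T.loadPiece k) (dir a u φ) = -(T.q k * u k ^ 2) := by
  simp only [loadPiece, qf_cross, dir, Sum.elim_inr]
  ring

/-- **The second variation is the quadratic form of the Gram matrix**:
`quad a u φ = qf matrix (dir a u φ)` (all `X′_dᵢ ≠ 0`). [cite: Padiyar2013, §3.4.4 eqs (3.32)–(3.37)] -/
theorem quad_eq_qf (T : HessianTables K m n) (hX : ∀ i, T.X i ≠ 0) (a : Fin m → K)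
    (u φ : Fin n → K) : T.quad a u φ = qf T.matrix (dir a u φ) := by
  rw [matrix, qf_add, qf_add, qf_sum, qf_sum, qf_sum]
  simp_rw [qf_sum, qf_machinePiece T _ a u φ (hX _), qf_networkPiece, qf_loadPiece]
  rw [quad, Finset.mul_sum, Finset.sum_neg_distrib, sub_eq_add_neg]
  congr 1
  congr 1
  refine Finset.sum_congr rfl fun k _ => ?_
  rw [Finset.mul_sum]

/-! ### From an `LDLᵀ` certificate of the pinned submatrix to positivity on pinned directions -/

/-- A sum over `Idx` of a function supported on the range of an injective `f : Fin N → Idx` is the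
sum over `Fin N`. [folklore] -/
theorem sum_eq_sum_comp {ι : Type*} [Fintype ι] [DecidableEq ι] {N : ℕ} {f : Fin N → ι}
    (hf : Function.Injective f) {R : Type*} [AddCommMonoid R] (g : ι → R)
    (hg : ∀ I, I ∉ Set.range f → g I = 0) : ∑ I, g I = ∑ i, g (f i) := by
  rw [← Finset.sum_image (f := g) (s := Finset.univ) (g := f) fun i _ j _ h => hf h]
  symm
  refine Finset.sum_subset (Finset.subset_univ _) fun I _ hI => hg I ?_
  intro ⟨i, hi⟩
  exact hI (Finset.mem_image.2 ⟨i, Finset.mem_univ _, hi⟩)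

/-- **Positivity on the pinned directions from the kernel certificate.** If the submatrix of the
rational Gram matrix on an injective index map `f : Fin N → Idx` (the pinning: `f` enumerates every
coordinate except the pinned bus angle) carries `PSD.LDLCertPD` (exact `LDLᵀ` with a positive margin,
decided in the kernel), then the quadratic form of the REAL-cast Gram matrix is positive at every
nonzero real direction supported on `range f`. [cite: BlekhermanParriloThomas2012, App. A.1.2] -/
theorem qf_pos_of_ldlCertPD {N : ℕ} (T : HessianTables ℚ m n) {f : Fin N → Idx m n}
    (hf : Function.Injective f) {Kk : ℕ} {ε₀ : ℚ}
    (hcert : Literature.Computation.Certificates.PSD.LDLCertPD (T.matrix.submatrix f f) Kk ε₀)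
    (d : Idx m n → ℝ) (hd : ∀ I, I ∉ Set.range f → d I = 0) (hd0 : d ≠ 0) :
    0 < qf (T.matrix.map (Rat.cast : ℚ → ℝ)) d := by
  classical
  set x : Fin N → ℝ := fun i => d (f i) with hxdef
  have hx0 : x ≠ 0 := by
    intro hx
    apply hd0
    funext I
    by_cases hI : I ∈ Set.range f
    · obtain ⟨i, rfl⟩ := hI
      exact congr_fun hx i
    · exact hd I hI
  have hpos := hcert.quadForm_pos (R := ℝ) hx0
  have hqf : qf (T.matrix.map (Rat.cast : ℚ → ℝ)) d
      = ∑ i, ∑ j, x i * ((T.matrix.submatrix f f) i j : ℝ) * x j := by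
    unfold qf
    rw [sum_eq_sum_comp hf _ fun I hI => by simp [hd I hI]]
    refine Finset.sum_congr rfl fun i _ => ?_
    rw [sum_eq_sum_comp hf _ fun J hJ => by simp [hd J hJ]]
    simp [Matrix.submatrix_apply, Matrix.map_apply, hxdef]
  rw [hqf]
  exact hpos

/-- **The bridge for instances**: real tables matching `(p, Q′_L, δ*, V*, θ*)` that are the cast of
rational tables `TQ` (half-angle operating point), all `X′_d ≠ 0`, and an `LDLCertPD` certificate of
the pinned rational Gram matrix (index map `f` missing exactly the bus angle `k₀`: every direction
with `φ_{k₀} = 0` is supported on `range f`) ⇒ `hessianQuad` is positive on every nonzero direction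
with `φ_{k₀} = 0` — the hypothesis of `energy_lt_of_hessianQuad_pos` /
`forall_dist_pinnedState_lt_of_hessianQuad_pos`. [cite: Padiyar2013, §3.4.4 eqs (3.32)–(3.37)];
[cite: BlekhermanParriloThomas2012, App. A.1.2] -/
theorem hessianQuad_pos_of_ldlCertPD {p : Params m n} {QL' : Fin n → ℝ → ℝ} {δ : Fin m → ℝ}
    {V θ : Fin n → ℝ} (TQ : HessianTables ℚ m n)
    (hT : (TQ.map (Rat.castHom ℝ)).Matches p QL' δ V θ) (hX : ∀ i, TQ.X i ≠ 0)
    {N : ℕ} {f : Fin N → Idx m n} (hf : Function.Injective f) (k₀ : Fin n)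
    (hrange : ∀ I : Idx m n, I ≠ Sum.inr (Sum.inl k₀) → I ∈ Set.range f) {Kk : ℕ} {ε₀ : ℚ}
    (hcert : Literature.Computation.Certificates.PSD.LDLCertPD (TQ.matrix.submatrix f f) Kk ε₀)
    (a : Fin m → ℝ) (u φ : Fin n → ℝ) (hφ : φ k₀ = 0) (hne : (a, u, φ) ≠ 0) :
    0 < p.hessianQuad QL' δ a V θ u φ := by
  have hXr : ∀ i, (TQ.map (Rat.castHom ℝ)).X i ≠ 0 := fun i => by
    simpa [map] using hX i
  rw [hessianQuad_eq_quad hT, quad_eq_qf _ hXr, matrix_map]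
  have hmapeq : TQ.matrix.map (Rat.castHom ℝ) = TQ.matrix.map (Rat.cast : ℚ → ℝ) := rfl
  rw [hmapeq]
  refine qf_pos_of_ldlCertPD TQ hf hcert (dir a u φ) (fun I hI => ?_) ?_
  · have hI : I = Sum.inr (Sum.inl k₀) := by
      by_contra h
      exact hI (hrange I h)
    subst hI
    simpa [dir] using hφ
  · intro h
    apply hne
    have ha : a = 0 := funext fun i => by simpa [dir] using congr_fun h (Sum.inl i)
    have hφ0 : φ = 0 := funext fun k => by simpa [dir] using congr_fun h (Sum.inr (Sum.inl k))
    have hu : u = 0 := funext fun k => by simpa [dir] using congr_fun h (Sum.inr (Sum.inr k))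
    simp [ha, hφ0, hu]

end HessianTables

end Summit.Ventures.GridStability.Models.StructurePreservingDAE

end
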